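import Literature.NumberTheory.Sieve.SmoothParityTernary
import Literature.NumberTheory.Sieve.SmoothArcClassesPointwise
import Literature.NumberTheory.Sieve.SmoothProfileSumsTransfer
import HarnessLib

/-!
# Parity-class friable ternary counts: the profile sums at one major-arc point

Topic `Literature/NumberTheory/Sieve`, namespace `Literature.NumberTheory.Sieve.SmoothArcs`; a PROVED file of the
circle-method engine of `SmoothParityTernary` ([Harper2016, §5]; [LagariasSoundararajan2012] for the conditional
asymptotic), the POINTWISE step on a major arc `θ = h/k + β`.  Notation: `α = α(x, y)` (`saddlePoint`),
`𝓜 = x^α ζ(α,y)/√(2πφ₂(α,y))`, scale `X = x/e`, `Mv = e^{−α}𝓜`, a `W`-class profile `c` with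
`S₁ = Σ_ℓ ‖c_ℓ‖(1+|ℓ|)`, `‖c‖_W = profileNorm c`, the class local factor `LF = classLocalFactor α m r k h`, its
cancelling majorant `Hc = classLocalHc α m r k h` (`‖LF‖ ≤ Hc`), the model sum `M(β) = profileModelSum c Mv X α β`.

* `norm_classArcSum_le_card`: the trivial bound `‖classArcSum X y m r k h λ‖ ≤ Ψ(X, y) = #S(X, y)`;
* `classProfileSum_major_point` (ONE VARIABLE): under the pointwise window hypothesis (hW) at precision `η` for
  the scalings `e' ≤ E` and the frequencies `|λ| ≤ Λ`, and the character-sum currency (hF) at `(ε₀, C_F)` — the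
  inputs of `classArcSum_estimate_pointwise` — for `y`-friable `k, m ≥ 1` with `e·lcm(k,m)² ≤ E` and `|βX| ≤ Λ/2`:
  `‖classProfileSum X y m r c (h/k + β) − LF · M(β)‖ ≤ Mv·Hc·[η S₁/(1+|βX|) + 12(1+|βX|)S₁/X + 16‖c‖_W/Λ³]`
  `+ [lcm(k,m) C_F X^{1/2+ε₀} lcm(k,m)^{ε₀} (1+|βX|)³ + 16 Ψ(X,y)/Λ³] ‖c‖_W`
  (arc transfer `classProfileSum_arc_transfer` of the class-arc estimate, then the model comparison
  `norm_profileModelSum_sub_le`);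
* `norm_triple_sub_triple_le` (ABSTRACT PRODUCT): if `‖V_i − L_i M_i‖ ≤ η H_i n_i t_i + F_i`, `‖L_i‖ ≤ H_i`,
  `‖M_i‖ ≤ 10 n_i t_i` (`0 ≤ t_i ≤ 1`, `0 ≤ η ≤ 1`), then
  `‖V₁V₂V̄₃ − L₁L₂L̄₃·M₁M₂M̄₃‖ ≤ 331 η Π(H_i n_i) · t₁t₂t₃ + 3(Π(11H_in_i + F_i) − Π 11H_in_i)`;
* small helpers for the three-variable instantiation (`major_point_weaken`, `major_point_flat_nonneg`,
  `norm_profileModelSum_le_inv_one_add`), carried out in the sequel `SmoothParityMajorPointTriple`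
  (`parity_major_point`: the product `V₁(d₁θ)V₂(σd₂θ)V̄₃(θ)` of the two odd-class sums and the free sum at
  `θ = a/k + β` against `LF₁LF₂L̄F₃ · M₁(d₁β)M₂(σd₂β)M̄₃(β)`).

Deliberately NOT here: the summation over the points of the major arcs and the singular series (the coefficients
`Σ_a LF₁LF₂L̄F₃` are the terms `paritySingTerm`), which is the business of the major-arc file.

## References

* A. J. Harper, Compositio Math. 152 (2016), §2.2, §5 [Harper2016].
* J. C. Lagarias, K. Soundararajan, Proc. LMS 104 (2012) [LagariasSoundararajan2012].
-/

noncomputable section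

open Finset Real Complex
open scoped FourierTransform

namespace Literature.NumberTheory.Sieve

namespace SmoothArcs

open TwistedWeight

/-! ### Trivial bound by the friable count -/

/-- `‖classArcSum X y m r k h λ‖ ≤ Ψ(X, y) = #S(X, y)` (each term has norm `≤ 1`). [folklore] -/
theorem norm_classArcSum_le_card (X : ℝ) (y m r k : ℕ) (h : ℤ) (lam : ℝ) :
    ‖classArcSum X y m r k h lam‖ ≤ ((Nat.smoothNumbersUpTo ⌊X⌋₊ (y + 1)).card : ℝ) := by
  unfold classArcSum
  set S := (Nat.smoothNumbersUpTo ⌊X⌋₊ (y + 1)).filter (fun n => n ≡ r [MOD m])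
  calc ‖∑ n ∈ S, (𝐞 ((h * n : ℝ) / k) : ℂ) * twistWeight lam (n / X)‖
      ≤ ∑ n ∈ S, ‖(𝐞 ((h * n : ℝ) / k) : ℂ) * twistWeight lam (n / X)‖ := norm_sum_le _ _
    _ ≤ ∑ n ∈ S, (1 : ℝ) := Finset.sum_le_sum fun n _ => by
        rw [norm_mul, Circle.norm_coe, one_mul]; exact norm_twistWeight_le _ _
    _ = S.card := by simp
    _ ≤ (Nat.smoothNumbersUpTo ⌊X⌋₊ (y + 1)).card := by exact_mod_cast Finset.card_filter_le _ _

/-! ### One variable at a major-arc point -/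

/-- **One profile sum at a major-arc point.**  Let `x > 1`, `y ≥ 2`, `α = α(x,y) ≤ 1`,
`𝓜 = x^α ζ(α,y)/√(2πφ₂(α,y))`, `Λ > 0`, `η ≥ 0`, `ε₀ > 0`, `C_F ≥ 0`, and assume (hW) the window evaluation
`‖S_w(λ; x/e') − e'^{−α}𝓜Ŵ_λ(α)‖ ≤ e'^{−α}η𝓜/(1+|λ|)` for `1 ≤ e' ≤ E`, `|λ| ≤ Λ`, and (hF) the currency
`‖Σ_{n ∈ S(X,y)} χ(n)W_λ(n/X)‖ ≤ C_F(1+|λ|)³X^{1/2+ε₀}q^{ε₀}` (`χ ≠ χ₀ mod q`, `X ≥ 1`).  Then for `1 ≤ e ≤ x`,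
`y`-friable `m, k ≥ 1` with `e·lcm(k,m)² ≤ E`, any class `r`, any `h ∈ ℤ`, a `W`-class profile `c` and `|βX| ≤ Λ/2`
(`X = x/e`, `Mv = e^{−α}𝓜`, `S₁ = Σ_ℓ‖c_ℓ‖(1+|ℓ|)`, `L = lcm(k,m)`):
`‖classProfileSum X y m r c (h/k + β) − classLocalFactor α m r k h · profileModelSum c Mv X α β‖`
`≤ Mv · classLocalHc α m r k h · (η S₁/(1+|βX|) + 12(1+|βX|)S₁/X + 16‖c‖_W/Λ³)`
`+ (L C_F X^{1/2+ε₀} L^{ε₀} (1+|βX|)³ + 16 Ψ(X,y)/Λ³) ‖c‖_W`.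
[cite: Harper2016, §2.2 (Major Arc Estimate 2) and §5] -/
theorem classProfileSum_major_point {x : ℝ} {y : ℕ} (hx : 1 < x) (hy : 2 ≤ y) (hα1 : saddlePoint x y ≤ 1)
    {Λ η E ε₀ C_F : ℝ} (hΛ : 0 < Λ) (hη : 0 ≤ η) (hε₀ : 0 < ε₀) (hC : 0 ≤ C_F)
    (hW : ∀ e' : ℕ, 1 ≤ e' → (e' : ℝ) ≤ E → ∀ lam : ℝ, |lam| ≤ Λ →
      ‖(∑ n ∈ Nat.smoothNumbersUpTo ⌊x / e'⌋₊ (y + 1), twistWeight lam (n / (x / e'))) -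
          ((((e' : ℝ) ^ (-saddlePoint x y) * (x ^ saddlePoint x y * smoothZeta (saddlePoint x y) y /
              Real.sqrt (2 * Real.pi * saddlePhi₂ (saddlePoint x y) y)) : ℝ)) : ℂ) * twistMellin lam (saddlePoint x y)‖ ≤
        (e' : ℝ) ^ (-saddlePoint x y) * (η * (x ^ saddlePoint x y * smoothZeta (saddlePoint x y) y /
          Real.sqrt (2 * Real.pi * saddlePhi₂ (saddlePoint x y) y)) / (1 + |lam|)))
    (hF : ∀ (q : ℕ) (χ : DirichletCharacter ℂ q), q ≠ 0 → χ ≠ 1 → ∀ (y : ℕ) (X lam : ℝ), 1 ≤ X →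
      ‖∑ n ∈ Nat.smoothNumbersUpTo ⌊X⌋₊ (y + 1), χ (n : ZMod q) * twistWeight lam (n / X)‖ ≤
        C_F * (1 + |lam|) ^ 3 * X ^ (1 / 2 + ε₀) * (q : ℝ) ^ ε₀)
    {e m r k : ℕ} (he : 1 ≤ e) (hex : (e : ℝ) ≤ x) (hm : 1 ≤ m) (hmS : m ∈ Nat.smoothNumbers (y + 1))
    (hk : 1 ≤ k) (hkS : k ∈ Nat.smoothNumbers (y + 1)) (hE : ((e * (Nat.lcm k m) ^ 2 : ℕ) : ℝ) ≤ E) (h : ℤ)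
    {c : ℤ → ℂ} (hc : Summable (fun ℓ : ℤ => ‖c ℓ‖ * (1 + |(ℓ : ℝ)|) ^ 3)) {β : ℝ}
    (hβ : |β * (x / e)| ≤ Λ / 2) :
    ‖classProfileSum (x / e) y m r c ((h : ℝ) / k + β) -
        classLocalFactor (saddlePoint x y) m r k h *
          profileModelSum c ((e : ℝ) ^ (-saddlePoint x y) * (x ^ saddlePoint x y * smoothZeta (saddlePoint x y) y /
            Real.sqrt (2 * Real.pi * saddlePhi₂ (saddlePoint x y) y))) (x / e) (saddlePoint x y) β‖ ≤
      (e : ℝ) ^ (-saddlePoint x y) * (x ^ saddlePoint x y * smoothZeta (saddlePoint x y) y /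
            Real.sqrt (2 * Real.pi * saddlePhi₂ (saddlePoint x y) y)) * classLocalHc (saddlePoint x y) m r k h *
          (η * (∑' ℓ : ℤ, ‖c ℓ‖ * (1 + |(ℓ : ℝ)|)) / (1 + |β * (x / e)|) +
            12 * (1 + |β * (x / e)|) * (∑' ℓ : ℤ, ‖c ℓ‖ * (1 + |(ℓ : ℝ)|)) / (x / e) +
            16 * profileNorm c / Λ ^ 3) +
        ((Nat.lcm k m : ℝ) * C_F * (x / e) ^ (1 / 2 + ε₀) * (Nat.lcm k m : ℝ) ^ ε₀ * (1 + |β * (x / e)|) ^ 3 +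
          16 * ((Nat.smoothNumbersUpTo ⌊x / e⌋₊ (y + 1)).card : ℝ) / Λ ^ 3) * profileNorm c := by
  have hx1 : 1 ≤ x := hx.le
  have harc0 := fun (lam' : ℝ) (hl : |lam'| ≤ Λ) =>
    classArcSum_estimate_pointwise (r := r) hx1 hε₀ hC hW hF he hm hmS hk hkS hE h hl
  set α : ℝ := saddlePoint x y with hα
  set M₀ : ℝ := x ^ α * smoothZeta α y / Real.sqrt (2 * Real.pi * saddlePhi₂ α y) with hM₀
  set Mv : ℝ := (e : ℝ) ^ (-α) * M₀ with hMv
  set X : ℝ := x / e with hX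
  set S₁ : ℝ := ∑' ℓ : ℤ, ‖c ℓ‖ * (1 + |(ℓ : ℝ)|) with hS₁
  set Hc : ℝ := classLocalHc α m r k h with hHc
  set LF : ℂ := classLocalFactor α m r k h with hLF
  set L : ℕ := Nat.lcm k m with hL
  set T : ℝ := ((Nat.smoothNumbersUpTo ⌊X⌋₊ (y + 1)).card : ℝ) + Hc * Mv with hT
  have hα0 : 0 < α := saddlePoint_pos hx hy
  have he0 : (0 : ℝ) < e := by exact_mod_cast he
  have hX1 : 1 ≤ X := by rw [hX, le_div_iff₀ he0, one_mul]; exact hex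
  have hX0 : 0 < X := by linarith
  have hM₀0 : 0 ≤ M₀ :=
    div_nonneg (mul_nonneg (Real.rpow_nonneg (by linarith) _) (smoothZeta_pos hα0).le) (Real.sqrt_nonneg _)
  have hMv0 : 0 ≤ Mv := mul_nonneg (Real.rpow_nonneg he0.le _) hM₀0
  have hHc0 : 0 ≤ Hc := classLocalHc_nonneg α m r k h
  have hLFle : ‖LF‖ ≤ Hc := norm_classLocalFactor_le hα0.le m r k h
  -- the arc hypothesis of the transfer lemma
  have harc : ∀ lam' : ℝ, |lam'| ≤ Λ →
      ‖classArcSum X y m r k h lam' - LF * (Mv : ℂ) * twistMellin lam' α‖ ≤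
        Mv * η * Hc / (1 + |lam'|) + (L : ℝ) * C_F * X ^ (1 / 2 + ε₀) * (L : ℝ) ^ ε₀ * (1 + |lam'|) ^ 3 := by
    intro lam' hl
    have h1 := harc0 lam' hl
    have e1 : LF * (Mv : ℂ) * twistMellin lam' α =
        classLocalFactor α m r k h * ((((e : ℝ) ^ (-α) * M₀ : ℝ) : ℂ) * twistMellin lam' α) := by
      rw [hLF, hMv]; ring
    rw [e1]
    refine h1.trans (le_of_eq ?_)
    rw [hMv]; ring
  have htriv : ∀ lam' : ℝ, ‖classArcSum X y m r k h lam'‖ ≤ T := fun lam' =>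
    (norm_classArcSum_le_card X y m r k h lam').trans (le_add_of_nonneg_right (mul_nonneg hHc0 hMv0))
  have hFT : ‖LF * (Mv : ℂ)‖ ≤ T := by
    rw [norm_mul, Complex.norm_real, Real.norm_of_nonneg hMv0]
    exact (mul_le_mul_of_nonneg_right hLFle hMv0).trans (le_add_of_nonneg_left (Nat.cast_nonneg _))
  have hA : 0 ≤ Mv * η * Hc := by positivity
  have hB : 0 ≤ (L : ℝ) * C_F * X ^ (1 / 2 + ε₀) * (L : ℝ) ^ ε₀ := by positivity
  have htr := classProfileSum_arc_transfer hc hΛ hβ hA hB hα0.le harc htriv hFT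
  have eθ : (h : ℝ) / k + β * X / X = (h : ℝ) / k + β := by rw [mul_div_cancel_right₀ β hX0.ne']
  rw [eθ] at htr
  -- the model comparison
  have hM1 := norm_profileModelSum_sub_le (summable_norm_mul_of_cube hc) hMv0 hX1 hα0.le hα1 β (c := c)
  have hsplit : classProfileSum X y m r c ((h : ℝ) / k + β) - LF * profileModelSum c Mv X α β =
      (classProfileSum X y m r c ((h : ℝ) / k + β) - LF * (Mv : ℂ) * profileMellin c α (β * X)) -
        LF * (profileModelSum c Mv X α β - (Mv : ℂ) * profileMellin c α (β * X)) := by ring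
  rw [hsplit]
  refine (norm_sub_le _ _).trans ?_
  rw [norm_mul]
  have h2 : ‖LF‖ * ‖profileModelSum c Mv X α β - (Mv : ℂ) * profileMellin c α (β * X)‖ ≤
      Hc * (12 * Mv * (1 + |β * X|) * S₁ / X) := mul_le_mul hLFle hM1 (norm_nonneg _) hHc0
  refine (add_le_add htr h2).trans (le_of_eq ?_)
  rw [hT]; ring

/-! ### The abstract product step -/

/-- Monotone expansion: for `0 ≤ q_i ≤ Q_i`, `0 ≤ f_i`,
`(q₁+f₁)(q₂+f₂)(q₃+f₃) ≤ q₁q₂q₃ + ((Q₁+f₁)(Q₂+f₂)(Q₃+f₃) − Q₁Q₂Q₃)`. [folklore] -/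
theorem prod_three_add_le {q₁ q₂ q₃ Q₁ Q₂ Q₃ f₁ f₂ f₃ : ℝ} (hq₁ : 0 ≤ q₁) (hq₂ : 0 ≤ q₂) (hq₃ : 0 ≤ q₃)
    (hf₁ : 0 ≤ f₁) (hf₂ : 0 ≤ f₂) (hf₃ : 0 ≤ f₃) (h₁ : q₁ ≤ Q₁) (h₂ : q₂ ≤ Q₂) (h₃ : q₃ ≤ Q₃) :
    (q₁ + f₁) * (q₂ + f₂) * (q₃ + f₃) ≤ q₁ * q₂ * q₃ + ((Q₁ + f₁) * (Q₂ + f₂) * (Q₃ + f₃) - Q₁ * Q₂ * Q₃) := by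
  have e1 : (q₁ + f₁) * (q₂ + f₂) * (q₃ + f₃) =
      q₁ * q₂ * q₃ + (f₁ * ((q₂ + f₂) * (q₃ + f₃)) + q₁ * (f₂ * (q₃ + f₃)) + q₁ * q₂ * f₃) := by ring
  have e2 : (Q₁ + f₁) * (Q₂ + f₂) * (Q₃ + f₃) - Q₁ * Q₂ * Q₃ =
      f₁ * ((Q₂ + f₂) * (Q₃ + f₃)) + Q₁ * (f₂ * (Q₃ + f₃)) + Q₁ * Q₂ * f₃ := by ring
  rw [e1, e2]
  have hQ₁ : 0 ≤ Q₁ := hq₁.trans h₁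
  have hQ₂ : 0 ≤ Q₂ := hq₂.trans h₂
  have i1 : f₁ * ((q₂ + f₂) * (q₃ + f₃)) ≤ f₁ * ((Q₂ + f₂) * (Q₃ + f₃)) :=
    mul_le_mul_of_nonneg_left (mul_le_mul (by linarith) (by linarith) (by positivity) (by linarith)) hf₁
  have i2 : q₁ * (f₂ * (q₃ + f₃)) ≤ Q₁ * (f₂ * (Q₃ + f₃)) :=
    mul_le_mul h₁ (mul_le_mul_of_nonneg_left (by linarith) hf₂) (by positivity) hQ₁
  have i3 : q₁ * q₂ * f₃ ≤ Q₁ * Q₂ * f₃ :=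
    mul_le_mul_of_nonneg_right (mul_le_mul h₁ h₂ hq₂ hQ₁) hf₃
  linarith

/-- `a h t ≤ 11 h` for `0 ≤ a ≤ 11`, `h ≥ 0`, `0 ≤ t ≤ 1`. [folklore] -/
private theorem mul_mul_le_eleven_mul {a h t : ℝ} (ha : 0 ≤ a) (ha1 : a ≤ 11) (hh : 0 ≤ h) (ht : 0 ≤ t)
    (ht1 : t ≤ 1) : a * h * t ≤ 11 * h := by
  have h0 : 0 ≤ h * t := mul_nonneg hh ht
  have h1 : a * t ≤ 11 := by nlinarith
  nlinarith

/-- `‖V‖ ≤ 11 h t + F` when `‖P‖ ≤ 10 h t` and `‖V − P‖ ≤ η h t + F` (`η ≤ 1`, `h, t ≥ 0`). [folklore] -/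
private theorem norm_le_eleven {V P : ℂ} {η h t F : ℝ} (hη1 : η ≤ 1) (hh : 0 ≤ h) (ht : 0 ≤ t)
    (hP : ‖P‖ ≤ 10 * h * t) (hE : ‖V - P‖ ≤ η * h * t + F) : ‖V‖ ≤ 11 * h * t + F := by
  have h1 : ‖V‖ ≤ ‖P‖ + ‖V - P‖ := by
    have := norm_add_le P (V - P); rwa [add_sub_cancel] at this
  have h2 : η * h * t ≤ 1 * h * t := by
    have := mul_nonneg hh ht
    nlinarith
  linarith

/-- **The abstract product step.**  Let `V_i, L_i, M_i ∈ ℂ` (`i = 1, 2, 3`) with `‖L_i‖ ≤ H_i`,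
`‖M_i‖ ≤ 10 n_i t_i`, `‖V_i − L_i M_i‖ ≤ η H_i n_i t_i + F_i`, where `0 ≤ t_i ≤ 1`, `0 ≤ η ≤ 1`, `n_i, F_i ≥ 0`.  Then
`‖V₁V₂V̄₃ − L₁L₂L̄₃ · M₁M₂M̄₃‖ ≤ 331 η (H₁n₁)(H₂n₂)(H₃n₃) t₁t₂t₃ + 3 (Π(11H_in_i + F_i) − Π 11H_in_i)`
(`V₁V₂V̄₃ − P₁P₂P̄₃ = E₁V₂V̄₃ + P₁E₂V̄₃ + P₁P₂Ē₃` with `P_i = L_iM_i`, `E_i = V_i − P_i`, `‖V_i‖ ≤ 11H_in_it_i + F_i`, and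
`prod_three_add_le` for each of the three terms: `121 + 110 + 100 = 331`). [folklore] -/
theorem norm_triple_sub_triple_le {V₁ V₂ V₃ L₁ L₂ L₃ M₁ M₂ M₃ : ℂ}
    {H₁ H₂ H₃ n₁ n₂ n₃ t₁ t₂ t₃ F₁ F₂ F₃ η : ℝ} (hη0 : 0 ≤ η) (hη1 : η ≤ 1)
    (ht₁ : 0 ≤ t₁) (ht₁1 : t₁ ≤ 1) (ht₂ : 0 ≤ t₂) (ht₂1 : t₂ ≤ 1) (ht₃ : 0 ≤ t₃) (ht₃1 : t₃ ≤ 1)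
    (hn₁ : 0 ≤ n₁) (hn₂ : 0 ≤ n₂) (hn₃ : 0 ≤ n₃) (hF₁ : 0 ≤ F₁) (hF₂ : 0 ≤ F₂) (hF₃ : 0 ≤ F₃)
    (hL₁ : ‖L₁‖ ≤ H₁) (hL₂ : ‖L₂‖ ≤ H₂) (hL₃ : ‖L₃‖ ≤ H₃)
    (hM₁ : ‖M₁‖ ≤ 10 * n₁ * t₁) (hM₂ : ‖M₂‖ ≤ 10 * n₂ * t₂) (hM₃ : ‖M₃‖ ≤ 10 * n₃ * t₃)
    (hV₁ : ‖V₁ - L₁ * M₁‖ ≤ η * H₁ * n₁ * t₁ + F₁) (hV₂ : ‖V₂ - L₂ * M₂‖ ≤ η * H₂ * n₂ * t₂ + F₂)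
    (hV₃ : ‖V₃ - L₃ * M₃‖ ≤ η * H₃ * n₃ * t₃ + F₃) :
    ‖V₁ * V₂ * starRingEnd ℂ V₃ - L₁ * L₂ * starRingEnd ℂ L₃ * (M₁ * M₂ * starRingEnd ℂ M₃)‖ ≤
      331 * η * (H₁ * n₁) * (H₂ * n₂) * (H₃ * n₃) * (t₁ * t₂ * t₃) +
        3 * ((11 * (H₁ * n₁) + F₁) * (11 * (H₂ * n₂) + F₂) * (11 * (H₃ * n₃) + F₃) -
          11 * (H₁ * n₁) * (11 * (H₂ * n₂)) * (11 * (H₃ * n₃))) := by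
  have hH₁ : 0 ≤ H₁ := (norm_nonneg _).trans hL₁
  have hH₂ : 0 ≤ H₂ := (norm_nonneg _).trans hL₂
  have hH₃ : 0 ≤ H₃ := (norm_nonneg _).trans hL₃
  have hh₁ : 0 ≤ H₁ * n₁ := mul_nonneg hH₁ hn₁
  have hh₂ : 0 ≤ H₂ * n₂ := mul_nonneg hH₂ hn₂
  have hh₃ : 0 ≤ H₃ * n₃ := mul_nonneg hH₃ hn₃
  have h11 : (0 : ℝ) ≤ 11 := by norm_num
  have h10 : (0 : ℝ) ≤ 10 := by norm_num
  -- the algebraic identity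
  have hid : V₁ * V₂ * starRingEnd ℂ V₃ - L₁ * L₂ * starRingEnd ℂ L₃ * (M₁ * M₂ * starRingEnd ℂ M₃) =
      (V₁ - L₁ * M₁) * V₂ * starRingEnd ℂ V₃ + L₁ * M₁ * (V₂ - L₂ * M₂) * starRingEnd ℂ V₃ +
        L₁ * M₁ * (L₂ * M₂) * starRingEnd ℂ (V₃ - L₃ * M₃) := by
    rw [map_sub, map_mul]; ring
  -- norms of the pieces
  have hp₁ : ‖L₁ * M₁‖ ≤ 10 * (H₁ * n₁) * t₁ := by
    rw [norm_mul]; exact (mul_le_mul hL₁ hM₁ (norm_nonneg _) hH₁).trans (le_of_eq (by ring))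
  have hp₂ : ‖L₂ * M₂‖ ≤ 10 * (H₂ * n₂) * t₂ := by
    rw [norm_mul]; exact (mul_le_mul hL₂ hM₂ (norm_nonneg _) hH₂).trans (le_of_eq (by ring))
  have hp₃ : ‖L₃ * M₃‖ ≤ 10 * (H₃ * n₃) * t₃ := by
    rw [norm_mul]; exact (mul_le_mul hL₃ hM₃ (norm_nonneg _) hH₃).trans (le_of_eq (by ring))
  have he₁ : ‖V₁ - L₁ * M₁‖ ≤ η * (H₁ * n₁) * t₁ + F₁ := hV₁.trans (le_of_eq (by ring))
  have he₂ : ‖V₂ - L₂ * M₂‖ ≤ η * (H₂ * n₂) * t₂ + F₂ := hV₂.trans (le_of_eq (by ring))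
  have he₃ : ‖starRingEnd ℂ (V₃ - L₃ * M₃)‖ ≤ η * (H₃ * n₃) * t₃ + F₃ := by
    rw [Complex.norm_conj]; exact hV₃.trans (le_of_eq (by ring))
  have hv₂ : ‖V₂‖ ≤ 11 * (H₂ * n₂) * t₂ + F₂ := norm_le_eleven hη1 hh₂ ht₂ hp₂ he₂
  have hv₃ : ‖starRingEnd ℂ V₃‖ ≤ 11 * (H₃ * n₃) * t₃ + F₃ := by
    rw [Complex.norm_conj]; exact norm_le_eleven hη1 hh₃ ht₃ hp₃ (hV₃.trans (le_of_eq (by ring)))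
  -- nonnegativity of the factors
  have q₁η : 0 ≤ η * (H₁ * n₁) * t₁ := mul_nonneg (mul_nonneg hη0 hh₁) ht₁
  have q₂η : 0 ≤ η * (H₂ * n₂) * t₂ := mul_nonneg (mul_nonneg hη0 hh₂) ht₂
  have q₃η : 0 ≤ η * (H₃ * n₃) * t₃ := mul_nonneg (mul_nonneg hη0 hh₃) ht₃
  have q₁t : 0 ≤ 10 * (H₁ * n₁) * t₁ := mul_nonneg (mul_nonneg h10 hh₁) ht₁
  have q₂t : 0 ≤ 10 * (H₂ * n₂) * t₂ := mul_nonneg (mul_nonneg h10 hh₂) ht₂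
  have q₂e : 0 ≤ 11 * (H₂ * n₂) * t₂ := mul_nonneg (mul_nonneg h11 hh₂) ht₂
  have q₃e : 0 ≤ 11 * (H₃ * n₃) * t₃ := mul_nonneg (mul_nonneg h11 hh₃) ht₃
  have hη11 : η ≤ 11 := by linarith
  have b₁η := mul_mul_le_eleven_mul hη0 hη11 hh₁ ht₁ ht₁1
  have b₂η := mul_mul_le_eleven_mul hη0 hη11 hh₂ ht₂ ht₂1
  have b₃η := mul_mul_le_eleven_mul hη0 hη11 hh₃ ht₃ ht₃1
  have b₁t := mul_mul_le_eleven_mul h10 (by norm_num) hh₁ ht₁ ht₁1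
  have b₂t := mul_mul_le_eleven_mul h10 (by norm_num) hh₂ ht₂ ht₂1
  have b₂e := mul_mul_le_eleven_mul h11 le_rfl hh₂ ht₂ ht₂1
  have b₃e := mul_mul_le_eleven_mul h11 le_rfl hh₃ ht₃ ht₃1
  -- term 1
  have T1 : ‖(V₁ - L₁ * M₁) * V₂ * starRingEnd ℂ V₃‖ ≤
      η * (H₁ * n₁) * t₁ * (11 * (H₂ * n₂) * t₂) * (11 * (H₃ * n₃) * t₃) +
        ((11 * (H₁ * n₁) + F₁) * (11 * (H₂ * n₂) + F₂) * (11 * (H₃ * n₃) + F₃) -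
          11 * (H₁ * n₁) * (11 * (H₂ * n₂)) * (11 * (H₃ * n₃))) := by
    rw [norm_mul, norm_mul]
    calc ‖V₁ - L₁ * M₁‖ * ‖V₂‖ * ‖starRingEnd ℂ V₃‖
        ≤ (η * (H₁ * n₁) * t₁ + F₁) * (11 * (H₂ * n₂) * t₂ + F₂) * (11 * (H₃ * n₃) * t₃ + F₃) :=
          mul_le_mul (mul_le_mul he₁ hv₂ (norm_nonneg _) (add_nonneg q₁η hF₁)) hv₃ (norm_nonneg _)
            (mul_nonneg (add_nonneg q₁η hF₁) (add_nonneg q₂e hF₂))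
      _ ≤ _ := prod_three_add_le q₁η q₂e q₃e hF₁ hF₂ hF₃ b₁η b₂e b₃e
  -- term 2
  have T2 : ‖L₁ * M₁ * (V₂ - L₂ * M₂) * starRingEnd ℂ V₃‖ ≤
      10 * (H₁ * n₁) * t₁ * (η * (H₂ * n₂) * t₂) * (11 * (H₃ * n₃) * t₃) +
        ((11 * (H₁ * n₁) + F₁) * (11 * (H₂ * n₂) + F₂) * (11 * (H₃ * n₃) + F₃) -
          11 * (H₁ * n₁) * (11 * (H₂ * n₂)) * (11 * (H₃ * n₃))) := by
    rw [norm_mul, norm_mul]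
    calc ‖L₁ * M₁‖ * ‖V₂ - L₂ * M₂‖ * ‖starRingEnd ℂ V₃‖
        ≤ (10 * (H₁ * n₁) * t₁ + F₁) * (η * (H₂ * n₂) * t₂ + F₂) * (11 * (H₃ * n₃) * t₃ + F₃) :=
          mul_le_mul (mul_le_mul (hp₁.trans (le_add_of_nonneg_right hF₁)) he₂ (norm_nonneg _)
            (add_nonneg q₁t hF₁)) hv₃ (norm_nonneg _) (mul_nonneg (add_nonneg q₁t hF₁) (add_nonneg q₂η hF₂))
      _ ≤ _ := prod_three_add_le q₁t q₂η q₃e hF₁ hF₂ hF₃ b₁t b₂η b₃e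
  -- term 3
  have T3 : ‖L₁ * M₁ * (L₂ * M₂) * starRingEnd ℂ (V₃ - L₃ * M₃)‖ ≤
      10 * (H₁ * n₁) * t₁ * (10 * (H₂ * n₂) * t₂) * (η * (H₃ * n₃) * t₃) +
        ((11 * (H₁ * n₁) + F₁) * (11 * (H₂ * n₂) + F₂) * (11 * (H₃ * n₃) + F₃) -
          11 * (H₁ * n₁) * (11 * (H₂ * n₂)) * (11 * (H₃ * n₃))) := by
    rw [norm_mul, norm_mul]
    calc ‖L₁ * M₁‖ * ‖L₂ * M₂‖ * ‖starRingEnd ℂ (V₃ - L₃ * M₃)‖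
        ≤ (10 * (H₁ * n₁) * t₁ + F₁) * (10 * (H₂ * n₂) * t₂ + F₂) * (η * (H₃ * n₃) * t₃ + F₃) :=
          mul_le_mul (mul_le_mul (hp₁.trans (le_add_of_nonneg_right hF₁))
            (hp₂.trans (le_add_of_nonneg_right hF₂)) (norm_nonneg _) (add_nonneg q₁t hF₁)) he₃ (norm_nonneg _)
            (mul_nonneg (add_nonneg q₁t hF₁) (add_nonneg q₂t hF₂))
      _ ≤ _ := prod_three_add_le q₁t q₂t q₃η hF₁ hF₂ hF₃ b₁t b₂t b₃η
  rw [hid]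
  refine norm_add₃_le.trans ?_
  refine (add_le_add (add_le_add T1 T2) T3).trans (le_of_eq ?_)
  ring

/-! ### Helpers for the three-variable product (used in `SmoothParityMajorPointTriple`) -/

/-- Weakening of the one-variable bound to the shape `η Hc (Mv S₁) t + F` with `t = 1/(1+|λ|)`, using `|λ| ≤ Λ` and
`lcm ≤ 2k`. [folklore] -/
theorem major_point_weaken {Mv Hc η S lam X pN Λ L C P ε₀ cd k2 : ℝ} (hMv : 0 ≤ Mv) (hHc : 0 ≤ Hc)
    (hS : 0 ≤ S) (hX : 0 < X) (hpN : 0 ≤ pN) (hL0 : 0 ≤ L) (hC : 0 ≤ C) (hP : 0 ≤ P)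
    (hε₀ : 0 ≤ ε₀) (hlam : |lam| ≤ Λ) (hL : L ≤ k2) :
    Mv * Hc * (η * S / (1 + |lam|) + 12 * (1 + |lam|) * S / X + 16 * pN / Λ ^ 3) +
        (L * C * P * L ^ ε₀ * (1 + |lam|) ^ 3 + 16 * cd / Λ ^ 3) * pN ≤
      η * Hc * (Mv * S) * (1 / (1 + |lam|)) +
        (Hc * Mv * (12 * (1 + Λ) * S / X + 16 * pN / Λ ^ 3) +
          (k2 * C * P * k2 ^ ε₀ * (1 + Λ) ^ 3 + 16 * cd / Λ ^ 3) * pN) := by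
  have hl0 : 0 ≤ |lam| := abs_nonneg lam
  have h1 : 12 * (1 + |lam|) * S / X ≤ 12 * (1 + Λ) * S / X := by
    apply div_le_div_of_nonneg_right _ hX.le
    nlinarith
  have hk2 : 0 ≤ k2 := hL0.trans hL
  have h2 : L * C * P * L ^ ε₀ * (1 + |lam|) ^ 3 ≤ k2 * C * P * k2 ^ ε₀ * (1 + Λ) ^ 3 :=
    mul_le_mul (mul_le_mul (mul_le_mul_of_nonneg_right (mul_le_mul_of_nonneg_right hL hC) hP)
      (Real.rpow_le_rpow hL0 hL hε₀) (Real.rpow_nonneg hL0 _) (by positivity))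
      (pow_le_pow_left₀ (by positivity) (by linarith) 3) (by positivity) (by positivity)
  have h3 : Mv * Hc * (12 * (1 + |lam|) * S / X) ≤ Mv * Hc * (12 * (1 + Λ) * S / X) :=
    mul_le_mul_of_nonneg_left h1 (mul_nonneg hMv hHc)
  have h4 : (L * C * P * L ^ ε₀ * (1 + |lam|) ^ 3) * pN ≤ (k2 * C * P * k2 ^ ε₀ * (1 + Λ) ^ 3) * pN :=
    mul_le_mul_of_nonneg_right h2 hpN
  have e : Mv * Hc * (η * S / (1 + |lam|) + 12 * (1 + |lam|) * S / X + 16 * pN / Λ ^ 3) +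
        (L * C * P * L ^ ε₀ * (1 + |lam|) ^ 3 + 16 * cd / Λ ^ 3) * pN =
      η * Hc * (Mv * S) * (1 / (1 + |lam|)) + (Mv * Hc * (12 * (1 + |lam|) * S / X) + Hc * Mv * (16 * pN / Λ ^ 3) +
        ((L * C * P * L ^ ε₀ * (1 + |lam|) ^ 3) * pN + 16 * cd / Λ ^ 3 * pN)) := by ring
  rw [e]
  have e' : Hc * Mv * (12 * (1 + Λ) * S / X + 16 * pN / Λ ^ 3) +
        (k2 * C * P * k2 ^ ε₀ * (1 + Λ) ^ 3 + 16 * cd / Λ ^ 3) * pN =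
      Mv * Hc * (12 * (1 + Λ) * S / X) + Hc * Mv * (16 * pN / Λ ^ 3) +
        ((k2 * C * P * k2 ^ ε₀ * (1 + Λ) ^ 3) * pN + 16 * cd / Λ ^ 3 * pN) := by ring
  rw [e']
  linarith

/-- The flat error `F` is nonnegative. [folklore] -/
theorem major_point_flat_nonneg {Hc Mv Λ S X pN k2 C P ε₀ cd : ℝ} (hHc : 0 ≤ Hc) (hMv : 0 ≤ Mv) (hΛ : 0 < Λ) (hS : 0 ≤ S)
    (hX : 0 < X) (hpN : 0 ≤ pN) (hk2 : 0 ≤ k2) (hC : 0 ≤ C) (hP : 0 ≤ P) (hcd : 0 ≤ cd) :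
    0 ≤ Hc * Mv * (12 * (1 + Λ) * S / X + 16 * pN / Λ ^ 3) + (k2 * C * P * k2 ^ ε₀ * (1 + Λ) ^ 3 + 16 * cd / Λ ^ 3) * pN := by
  positivity

/-- `‖M(β')‖ ≤ 10 (Mv S₁) · 1/(1+|β'X|)` for `|β'X| ≤ Λ/2`, `Λ ≤ X`, `X ≥ 1` (`norm_profileModelSum_le_div_one_add`).
[folklore] -/
theorem norm_profileModelSum_le_inv_one_add {c : ℤ → ℂ} (hc : Summable (fun ℓ : ℤ => ‖c ℓ‖ * (1 + |(ℓ : ℝ)|) ^ 3))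
    {Mv X α Λ β' : ℝ} (hMv : 0 ≤ Mv) (hX : 1 ≤ X) (hα : 0 ≤ α) (hα1 : α ≤ 1) (hΛX : Λ ≤ X)
    (hβ : |β' * X| ≤ Λ / 2) :
    ‖profileModelSum c Mv X α β'‖ ≤ 10 * (Mv * ∑' ℓ : ℤ, ‖c ℓ‖ * (1 + |(ℓ : ℝ)|)) * (1 / (1 + |β' * X|)) := by
  have hX0 : 0 < X := by linarith
  have hβX : |β' * X| = X * |β'| := by rw [abs_mul, abs_of_pos hX0, mul_comm]
  have hβ2 : |β'| ≤ 1 / 2 := by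
    rw [hβX] at hβ
    rw [le_div_iff₀ (by norm_num : (0:ℝ) < 2)]
    nlinarith [abs_nonneg β']
  have h := norm_profileModelSum_le_div_one_add (summable_norm_mul_of_cube hc) hMv hX hα hα1 hβ2 (c := c)
  rw [hβX]
  refine h.trans (le_of_eq ?_)
  ring

end SmoothArcs

end Literature.NumberTheory.Sieve

end
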